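import Summits.RiemannHypothesis.RiemannHypothesis.Theorems.HandoffSemilocalParitySplit
import Summits.RiemannHypothesis.RiemannHypothesis.Theorems.SemilocalDeletionDipole
import Literature.NumberTheory.LFunctions.WeilSmallSupportPositivity
import Literature.NumberTheory.LFunctions.WeilWindowSimpleEven
import Literature.NumberTheory.LFunctions.WeilMellinBounds
import HarnessLib

/-!
# The HALF-ROOM LAW of the prime-deletion cliff: `−Λ(p)/√p ≤ λ_min(S∖{p}; (log p)/2 + δ; σ) ≤ −Λ(p)/√p + 2·λ_min(S; δ; σ̄)`

Sequel to `SemilocalDeletionDipole.lean` (the floor `−log p/√p` of the deleted semi-local form is attained EXACTLY on the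
antisymmetric dipoles `d_h = h(· + (log p)/2) − h(· − (log p)/2)`, `h ∈ C(δ)`).  Numerics of the `rh-explicit` cell (seat cc-s2-1
gen9, WALSH-E §4 / SWAPCHECK: 33 certified sector-swapped ratios) found the offset above the floor at the window `(log p)/2 + δ`
to be governed by the HALF-ROOM `δ` with the parity SWAPPED: `Δ_σ ≈ ε_σ̄(δ)/3`, `Δ_σ/ε_σ̄(δ) ∈ [0.08, 0.60]`.  Here that law
becomes a two-sided THEOREM with the constant `2`, under the single hypothesis that the UNDELETED form is positive at the window:

* §1–§2 parallelogram law and translation invariance of `Q_S` ⇒ **`re_weilSemilocalQuadratic_dipole_le`**: if `Re Q_S ≥ 0` on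
  `C(L/2 + δ)` then `Re Q_S(d_h) ≤ 4·Re Q_S(h)` for every block `h ∈ C(δ)` (`Q_S(d_h) + Q_S(h₊ + h₋) = 4Q_S(h)`);
* §3 **the half-room law** (`p ∈ S` prime, `0 < δ`, `2δ < log p`, `WeilSemilocalPositivityOn S ((log p)/2 + δ)`):
  `λ_min(S∖{p}; (log p)/2 + δ; odd) ∈ [−log p/√p, −log p/√p + 2·λ_min(S; δ; even)]`, the same with even/odd exchanged, and
  `λ_min(S∖{p}; (log p)/2 + δ) ∈ [−log p/√p, −log p/√p + 2·λ_min(S; δ)]` (`semilocalGroundEnergy_erase_*_mem_Icc`);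
* §4 wall language (consecutive primes `q < q'`, `S_{q'} ∖ {q} = S_q`, the rung `WeilPositivityOn((log q)/2 + δ)` with
  `(log q)/2 + δ ≤ (log q')/2`): `λ_min(S_q; (log q)/2 + δ; σ) ∈ [−log q/√q, −log q/√q + 2·ε_σ̄(δ)]` with the tree's
  sector energies, i.e. `cap(q) − 2ε(δ) ≤ D_q((log q)/2 + δ) ≤ cap(q)` for theory-2's aggregate deficit (`aggregateDeficit_mem_Icc`);
* UNCONDITIONAL instances from the tree's rungs (the `{∞}` form on `((log 2)/2, (log 3)/2]`, Connes–Consani's `{∞, 2}` form on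
  `((log 3)/2, (log 5)/2]`) live in the sequel `SemilocalDeletionDipoleHalfRoomRungs.lean` (heavier import closure).

What remains data is the constant (`≈ 1/3` observed vs `2` proved).  Nothing here bears on RH.
-/

set_option linter.dupNamespace false

noncomputable section

open Complex Filter Set MeasureTheory
open scoped Real Topology ComplexConjugate


namespace Summit.RiemannHypothesis.RiemannHypothesis.Theorems.SemilocalDeletionDipoleHalfRoom

open Literature.NumberTheory.LFunctions
open Summit.RiemannHypothesis.RiemannHypothesis.Theorems.HandoffSemilocalEnergy
open Summit.RiemannHypothesis.RiemannHypothesis.Theorems.HandoffSemilocalParitySplit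
open Summit.RiemannHypothesis.RiemannHypothesis.Theorems.SemilocalDeletionDipole
open Summit.RiemannHypothesis.RiemannHypothesis.Theorems.SemilocalDeletionCliff

variable {g h : ℝ → ℂ} {δ L : ℝ} {S : Finset ℕ}

/-! ## §1  `Q_S` is a quadratic form: sign, parallelogram law, translation invariance -/

/-- `(−h)̃ = −h̃`. -/
theorem weilReflect_neg' (h : ℝ → ℂ) : weilReflect (-h) = -weilReflect h := by
  funext t; simp [weilReflect]

/-- `g ⋆ (−k) = −(g ⋆ k)`. -/
theorem weilConv_neg_right (g k : ℝ → ℂ) : weilConv g (-k) = -weilConv g k := by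
  have e1 : -k = fun t ↦ (-1 : ℂ) * k t := by funext t; simp
  rw [e1, weilConv_const_mul_right]
  funext t; simp

/-- `(−g) ⋆ k = −(g ⋆ k)`. -/
theorem weilConv_neg_left (g k : ℝ → ℂ) : weilConv (-g) k = -weilConv g k := by
  have e1 : -g = fun t ↦ (-1 : ℂ) * g t := by funext t; simp
  rw [e1, weilConv_const_mul_left]
  funext t; simp

/-- `W_S(−K) = −W_S(K)`. -/
theorem weilSemilocalFunctional_neg (S : Finset ℕ) (K : ℝ → ℂ) :
    weilSemilocalFunctional S (-K) = -weilSemilocalFunctional S K := by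
  have e1 : -K = fun t ↦ (-1 : ℂ) * K t := by funext t; simp
  rw [e1, weilSemilocalFunctional_const_mul, neg_one_mul]

/-- `Q_S(−g) = Q_S(g)`. -/
theorem weilSemilocalQuadratic_neg (S : Finset ℕ) (g : ℝ → ℂ) :
    weilSemilocalQuadratic S (-g) = weilSemilocalQuadratic S g := by
  unfold weilSemilocalQuadratic
  rw [weilReflect_neg', weilConv_neg_left, weilConv_neg_right, neg_neg]

/-- `−h` is a test function. -/
theorem isWeilTest_neg (hh : IsWeilTest h) : IsWeilTest (-h) := by
  have := hh.const_mul (-1)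
  convert this using 1
  funext t; simp

/-- **Parallelogram law** for the semi-local form: `Q_S(g + h) + Q_S(g − h) = 2Q_S(g) + 2Q_S(h)`. -/
theorem weilSemilocalQuadratic_parallelogram (S : Finset ℕ) (hg : IsWeilTest g) (hh : IsWeilTest h) :
    weilSemilocalQuadratic S (g + h) + weilSemilocalQuadratic S (g - h) =
      2 * weilSemilocalQuadratic S g + 2 * weilSemilocalQuadratic S h := by
  have h1 := weilSemilocalQuadratic_add S hg hh
  have h2 := weilSemilocalQuadratic_add S hg (isWeilTest_neg hh)
  rw [← sub_eq_add_neg, weilSemilocalQuadratic_neg, weilReflect_neg', weilConv_neg_right, weilConv_neg_left,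
    weilSemilocalFunctional_neg, weilSemilocalFunctional_neg] at h2
  rw [h1, h2]
  ring

/-- **Translation invariance**: `Q_S(g(· + m)) = Q_S(g)` (the autocorrelation `g ⋆ g̃` is translation invariant). -/
theorem weilSemilocalQuadratic_translate (S : Finset ℕ) (g : ℝ → ℂ) (m : ℝ) :
    weilSemilocalQuadratic S (fun t ↦ g (t + m)) = weilSemilocalQuadratic S g := by
  unfold weilSemilocalQuadratic
  rw [weilConv_weilReflect_translate]

/-! ## §2  The dipole against the symmetric pair: `Re Q_S(d_h) ≤ 4 Re Q_S(h)` under positivity at the window -/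

/-- Support of the symmetric pair `s_h(t) = h(t + L/2) + h(t − L/2)`: inside `[−(L/2 + δ), L/2 + δ]` for `h ∈ C(δ)`, `L ≥ 0`. -/
theorem tsupport_symPair_subset (hsupp : tsupport h ⊆ Icc (-δ) δ) (hL : 0 ≤ L) :
    tsupport ((fun t ↦ h (t + L / 2)) + fun t ↦ h (t - L / 2)) ⊆ Icc (-(L / 2 + δ)) (L / 2 + δ) := by
  refine (isClosed_Icc.closure_subset_iff).2 fun t ht ↦ ?_
  rw [Function.mem_support, Pi.add_apply] at ht
  by_cases h1 : h (t + L / 2) = 0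
  · have h2 : h (t - L / 2) ≠ 0 := fun h2 ↦ ht (by rw [h1, h2, add_zero])
    have := hsupp (subset_tsupport _ (Function.mem_support.2 h2))
    rw [mem_Icc] at this ⊢
    constructor <;> linarith [this.1, this.2]
  · have := hsupp (subset_tsupport _ (Function.mem_support.2 h1))
    rw [mem_Icc] at this ⊢
    constructor <;> linarith [this.1, this.2]

/-- **The dipole costs at most four blocks.** If the semi-local form `Q_S` is positive on the window `C(L/2 + δ)` then for every
block `h ∈ C(δ)` (`L ≥ 0`): `Re Q_S(d_h) ≤ 4·Re Q_S(h)`, `d_h(t) = h(t + L/2) − h(t − L/2)` — parallelogram law with the symmetric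
pair `s_h = h₊ + h₋ ∈ C(L/2 + δ)` (`Re Q_S(s_h) ≥ 0`) and translation invariance `Q_S(h₊) = Q_S(h₋) = Q_S(h)`. -/
theorem re_weilSemilocalQuadratic_dipole_le (hh : IsWeilTest h) (hsupp : tsupport h ⊆ Icc (-δ) δ) (hL : 0 ≤ L)
    (hpos : WeilSemilocalPositivityOn S (L / 2 + δ)) :
    (weilSemilocalQuadratic S (fun t ↦ h (t + L / 2) - h (t - L / 2))).re ≤ 4 * (weilSemilocalQuadratic S h).re := by
  have htp : IsWeilTest (fun t ↦ h (t + L / 2)) := by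
    have := hh.weilTranslate (-(L / 2))
    convert this using 1
    funext t; simp only [weilTranslate, sub_neg_eq_add]
  have htm : IsWeilTest (fun t ↦ h (t - L / 2)) := hh.weilTranslate (L / 2)
  have hpar := weilSemilocalQuadratic_parallelogram S htp htm
  have hQp : weilSemilocalQuadratic S (fun t ↦ h (t + L / 2)) = weilSemilocalQuadratic S h :=
    weilSemilocalQuadratic_translate S h (L / 2)
  have hQm : weilSemilocalQuadratic S (fun t ↦ h (t - L / 2)) = weilSemilocalQuadratic S h := by
    have := weilSemilocalQuadratic_translate S h (-(L / 2))
    simp only [← sub_eq_add_neg] at this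
    exact this
  have h0 := hpos _ (htp.add htm) (tsupport_symPair_subset hsupp hL)
  have e : (fun t ↦ h (t + L / 2) - h (t - L / 2)) = (fun t ↦ h (t + L / 2)) - fun t ↦ h (t - L / 2) := rfl
  rw [e]
  have := congrArg Complex.re hpar
  rw [hQp, hQm, Complex.add_re, Complex.add_re] at this
  have h2 : ((2 : ℂ) * weilSemilocalQuadratic S h).re = 2 * (weilSemilocalQuadratic S h).re := by
    simp [Complex.mul_re]
  rw [h2] at this
  linarith


/-! ## §3  The half-room law: `−Λ(p)/√p ≤ λ_min(S∖{p}; (log p)/2 + δ; σ) ≤ −Λ(p)/√p + 2·λ_min(S; δ; σ̄)` under positivity at the window -/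

variable {p : ℕ} {P : (ℝ → ℂ) → Prop}

/-- The dipole test improved by the parallelogram law: under positivity of `Q_S` on `C((log p)/2 + δ)`, for every block
`h ∈ C(δ)` whose dipole (with its positive multiples) satisfies `P`:
`(λ_min(S∖{p}; (log p)/2 + δ; P) + log p/√p)·‖h‖₂² ≤ 2·Re Q_S(h)`. -/
theorem semilocalGroundEnergy_erase_add_mul_le_two_mul (hh : IsWeilTest h) (hsupp : tsupport h ⊆ Icc (-δ) δ)
    (hp : p.Prime) (hpS : p ∈ S) (hδ : 2 * δ < Real.log p) (hpos : WeilSemilocalPositivityOn S (Real.log p / 2 + δ))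
    (hP : ∀ a : ℝ, 0 < a → P fun t ↦ (a : ℂ) * (h (t + Real.log p / 2) - h (t - Real.log p / 2))) :
    (semilocalGroundEnergy (S.erase p) P (Real.log p / 2 + δ) + Real.log p / Real.sqrt p) * ∫ u : ℝ, ‖h u‖ ^ 2 ≤
      2 * (weilSemilocalQuadratic S h).re := by
  have h1 := semilocalGroundEnergy_erase_add_mul_le hh hsupp hp hpS hδ hP
  have h2 := re_weilSemilocalQuadratic_dipole_le (S := S) hh hsupp (log_prime_pos hp).le hpos
  have e : (semilocalGroundEnergy (S.erase p) P (Real.log p / 2 + δ) + Real.log p / Real.sqrt p) *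
      (2 * ∫ u : ℝ, ‖h u‖ ^ 2) =
      2 * ((semilocalGroundEnergy (S.erase p) P (Real.log p / 2 + δ) + Real.log p / Real.sqrt p) *
        ∫ u : ℝ, ‖h u‖ ^ 2) := by ring
  rw [e] at h1
  linarith

/-- **THE HALF-ROOM LAW, odd sector ← even blocks.** `p ∈ S` prime, `0 < δ`, `2δ < log p`, `Q_S ≥ 0` on `C((log p)/2 + δ)`:
`λ_min(S∖{p}; (log p)/2 + δ; odd) ≤ −log p/√p + 2·λ_min(S; δ; even)`. -/
theorem semilocalGroundEnergy_erase_odd_le (hp : p.Prime) (hpS : p ∈ S) (hδ0 : 0 < δ) (hδ : 2 * δ < Real.log p)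
    (hpos : WeilSemilocalPositivityOn S (Real.log p / 2 + δ)) :
    semilocalGroundEnergy (S.erase p) (fun g ↦ ∀ t, g (-t) = -g t) (Real.log p / 2 + δ) ≤
      -(Real.log p / Real.sqrt p) + 2 * semilocalGroundEnergy S (fun g ↦ ∀ t, g (-t) = g t) δ := by
  have key : (semilocalGroundEnergy (S.erase p) (fun g ↦ ∀ t, g (-t) = -g t) (Real.log p / 2 + δ) +
      Real.log p / Real.sqrt p) / 2 ≤ semilocalGroundEnergy S (fun g ↦ ∀ t, g (-t) = g t) δ := by
    refine le_semilocalGroundEnergy (semilocalSphereValues_even_nonempty S hδ0) fun g hg hs hPg hn ↦ ?_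
    have := semilocalGroundEnergy_erase_add_mul_le_two_mul (P := fun g ↦ ∀ t, g (-t) = -g t) hg hs hp hpS hδ hpos
      fun a _ t ↦ by
        show (a : ℂ) * (g (-t + Real.log p / 2) - g (-t - Real.log p / 2)) =
          -((a : ℂ) * (g (t + Real.log p / 2) - g (t - Real.log p / 2)))
        rw [dipole_odd_of_even hPg]
        ring
    rw [hn, mul_one] at this
    linarith
  linarith

/-- **THE HALF-ROOM LAW, even sector ← odd blocks.** `λ_min(S∖{p}; (log p)/2 + δ; even) ≤ −log p/√p + 2·λ_min(S; δ; odd)`. -/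
theorem semilocalGroundEnergy_erase_even_le (hp : p.Prime) (hpS : p ∈ S) (hδ0 : 0 < δ) (hδ : 2 * δ < Real.log p)
    (hpos : WeilSemilocalPositivityOn S (Real.log p / 2 + δ)) :
    semilocalGroundEnergy (S.erase p) (fun g ↦ ∀ t, g (-t) = g t) (Real.log p / 2 + δ) ≤
      -(Real.log p / Real.sqrt p) + 2 * semilocalGroundEnergy S (fun g ↦ ∀ t, g (-t) = -g t) δ := by
  have key : (semilocalGroundEnergy (S.erase p) (fun g ↦ ∀ t, g (-t) = g t) (Real.log p / 2 + δ) +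
      Real.log p / Real.sqrt p) / 2 ≤ semilocalGroundEnergy S (fun g ↦ ∀ t, g (-t) = -g t) δ := by
    refine le_semilocalGroundEnergy (semilocalSphereValues_odd_nonempty S hδ0) fun g hg hs hPg hn ↦ ?_
    have := semilocalGroundEnergy_erase_add_mul_le_two_mul (P := fun g ↦ ∀ t, g (-t) = g t) hg hs hp hpS hδ hpos
      fun a _ t ↦ by
        show (a : ℂ) * (g (-t + Real.log p / 2) - g (-t - Real.log p / 2)) =
          (a : ℂ) * (g (t + Real.log p / 2) - g (t - Real.log p / 2))
        rw [dipole_even_of_odd hPg]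
    rw [hn, mul_one] at this
    linarith
  linarith

/-- **THE HALF-ROOM LAW, all sectors.** `λ_min(S∖{p}; (log p)/2 + δ) ≤ −log p/√p + 2·λ_min(S; δ)`. -/
theorem semilocalGroundEnergy_erase_top_le (hp : p.Prime) (hpS : p ∈ S) (hδ0 : 0 < δ) (hδ : 2 * δ < Real.log p)
    (hpos : WeilSemilocalPositivityOn S (Real.log p / 2 + δ)) :
    semilocalGroundEnergy (S.erase p) (fun _ ↦ True) (Real.log p / 2 + δ) ≤
      -(Real.log p / Real.sqrt p) + 2 * semilocalGroundEnergy S (fun _ ↦ True) δ := by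
  have key : (semilocalGroundEnergy (S.erase p) (fun _ ↦ True) (Real.log p / 2 + δ) +
      Real.log p / Real.sqrt p) / 2 ≤ semilocalGroundEnergy S (fun _ ↦ True) δ := by
    refine le_semilocalGroundEnergy (semilocalSphereValues_top_nonempty S hδ0) fun g hg hs _ hn ↦ ?_
    have := semilocalGroundEnergy_erase_add_mul_le_two_mul (P := fun _ ↦ True) hg hs hp hpS hδ hpos
      fun _ _ ↦ trivial
    rw [hn, mul_one] at this
    linarith
  linarith

/-- Under positivity of `Q_S` on `C(c)`, `c < log p`, every constrained bottom of the deleted form sits ON OR ABOVE the floor: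
`−log p/√p ≤ λ_min(S∖{p}; c; P)` (for scaling-stable `P`). -/
theorem neg_le_semilocalGroundEnergy_erase (hp : p.Prime) (hpS : p ∈ S) {c : ℝ} (hc : c < Real.log p)
    (hpos : WeilSemilocalPositivityOn S c) (hP : ∀ (a : ℝ) (g : ℝ → ℂ), 0 < a → P g → P fun t ↦ (a : ℂ) * g t) :
    -(Real.log p / Real.sqrt p) ≤ semilocalGroundEnergy (S.erase p) P c := by
  have h1 := semilocalGroundEnergy_erase_ge (P := P) hp hpS hc
  have h0 : 0 ≤ semilocalGroundEnergy S P c :=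
    (semilocalGroundEnergy_nonneg_iff hP).2 fun g hg hs _ ↦ hpos g hg hs
  linarith

/-- **THE SANDWICH, odd sector**: under `Q_S ≥ 0` on `C((log p)/2 + δ)` (`p ∈ S` prime, `0 < δ`, `2δ < log p`),
`λ_min(S∖{p}; (log p)/2 + δ; odd) ∈ [−log p/√p, −log p/√p + 2·λ_min(S; δ; even)]`. -/
theorem semilocalGroundEnergy_erase_odd_mem_Icc (hp : p.Prime) (hpS : p ∈ S) (hδ0 : 0 < δ) (hδ : 2 * δ < Real.log p)
    (hpos : WeilSemilocalPositivityOn S (Real.log p / 2 + δ)) :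
    semilocalGroundEnergy (S.erase p) (fun g ↦ ∀ t, g (-t) = -g t) (Real.log p / 2 + δ) ∈
      Icc (-(Real.log p / Real.sqrt p))
        (-(Real.log p / Real.sqrt p) + 2 * semilocalGroundEnergy S (fun g ↦ ∀ t, g (-t) = g t) δ) :=
  ⟨neg_le_semilocalGroundEnergy_erase hp hpS (by linarith) hpos fun a g _ hg t ↦ by simp only [hg t, mul_neg],
    semilocalGroundEnergy_erase_odd_le hp hpS hδ0 hδ hpos⟩

/-- **THE SANDWICH, even sector**: `λ_min(S∖{p}; (log p)/2 + δ; even) ∈ [−log p/√p, −log p/√p + 2·λ_min(S; δ; odd)]`. -/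
theorem semilocalGroundEnergy_erase_even_mem_Icc (hp : p.Prime) (hpS : p ∈ S) (hδ0 : 0 < δ) (hδ : 2 * δ < Real.log p)
    (hpos : WeilSemilocalPositivityOn S (Real.log p / 2 + δ)) :
    semilocalGroundEnergy (S.erase p) (fun g ↦ ∀ t, g (-t) = g t) (Real.log p / 2 + δ) ∈
      Icc (-(Real.log p / Real.sqrt p))
        (-(Real.log p / Real.sqrt p) + 2 * semilocalGroundEnergy S (fun g ↦ ∀ t, g (-t) = -g t) δ) :=
  ⟨neg_le_semilocalGroundEnergy_erase hp hpS (by linarith) hpos fun a g _ hg t ↦ by simp only [hg t],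
    semilocalGroundEnergy_erase_even_le hp hpS hδ0 hδ hpos⟩

/-- **THE SANDWICH, all sectors**: `λ_min(S∖{p}; (log p)/2 + δ) ∈ [−log p/√p, −log p/√p + 2·λ_min(S; δ)]`. -/
theorem semilocalGroundEnergy_erase_top_mem_Icc (hp : p.Prime) (hpS : p ∈ S) (hδ0 : 0 < δ) (hδ : 2 * δ < Real.log p)
    (hpos : WeilSemilocalPositivityOn S (Real.log p / 2 + δ)) :
    semilocalGroundEnergy (S.erase p) (fun _ ↦ True) (Real.log p / 2 + δ) ∈
      Icc (-(Real.log p / Real.sqrt p)) (-(Real.log p / Real.sqrt p) + 2 * semilocalGroundEnergy S (fun _ ↦ True) δ) :=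
  ⟨neg_le_semilocalGroundEnergy_erase hp hpS (by linarith) hpos fun _ _ _ _ ↦ trivial,
    semilocalGroundEnergy_erase_top_le hp hpS hδ0 hδ hpos⟩


/-! ## §4  Wall language: consecutive primes `q < q'`, the OLD form `Q_{S_q}` just past its entrance `(log q)/2` -/

variable {q q' : ℕ}

open Summit.RiemannHypothesis.RiemannHypothesis.Theorems.Handoff

/-- For consecutive primes `q < q'`: `S_{q'} ∖ {q} = S_q`. -/
theorem primesBelow_erase_eq (h : ConsecutivePrimes q q') : (Nat.primesBelow q').erase q = Nat.primesBelow q := by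
  rw [h.primesBelow_eq, Nat.primesBelow_succ, if_pos h.1]
  exact Finset.erase_insert (by simp [Nat.mem_primesBelow])

/-- `q ∈ S_{q'}`. -/
theorem mem_primesBelow_of_consecutive (h : ConsecutivePrimes q q') : q ∈ Nat.primesBelow q' :=
  Nat.mem_primesBelow.2 ⟨h.2.2.1, h.1⟩

/-- On the new cone `C((log q')/2)` the `S_{q'}`-form is Weil's form, so its positivity there is `WeilPositivityOn`. -/
theorem weilSemilocalPositivityOn_primesBelow_of_weilPositivityOn (h : ConsecutivePrimes q q') {b : ℝ}
    (hb : b ≤ Real.log q' / 2) (hpos : WeilPositivityOn b) : WeilSemilocalPositivityOn (Nat.primesBelow q') b := by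
  have hS := primeFactors_subset_primesBelow_succ_of_gap h.gap
  rw [← h.primesBelow_eq] at hS
  have hb' : b ≤ Real.log (((q' - 1 : ℕ) : ℝ) + 1) / 2 := by rwa [h.cast_pred_add_one]
  exact (MotivicDoor.Semilocal.weilSemilocalPositivityOn_iff_weilPositivityOn_of_le hS hb').2 hpos

/-- **THE HALF-ROOM LAW AT A WALL, odd sector.** Consecutive primes `q < q'`, a half-room `0 < δ` with
`(log q)/2 + δ ≤ (log q')/2` and `2δ < log q`, and Weil positivity on `C((log q)/2 + δ)` (a rung): the free-odd bottom of the
OLD form `Q_{S_q}` just past its entrance satisfies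
`−log q/√q ≤ λ_min(S_q; (log q)/2 + δ; odd) ≤ −log q/√q + 2·ε_ev(δ)`. -/
theorem semilocalGroundEnergy_primesBelow_odd_mem_Icc (h : ConsecutivePrimes q q') (hδ0 : 0 < δ)
    (hδq' : Real.log q / 2 + δ ≤ Real.log q' / 2) (hδ : 2 * δ < Real.log q) (hpos : WeilPositivityOn (Real.log q / 2 + δ)) :
    semilocalGroundEnergy (Nat.primesBelow q) (fun g ↦ ∀ t, g (-t) = -g t) (Real.log q / 2 + δ) ∈
      Icc (-(Real.log q / Real.sqrt q)) (-(Real.log q / Real.sqrt q) + 2 * weilEvenGroundEnergy δ) := by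
  have hposS := weilSemilocalPositivityOn_primesBelow_of_weilPositivityOn h hδq' hpos
  have hm := semilocalGroundEnergy_erase_odd_mem_Icc h.1 (mem_primesBelow_of_consecutive h) hδ0 hδ hposS
  have hδ' : δ ≤ Real.log q' / 2 := by linarith [log_prime_pos h.1]
  rwa [primesBelow_erase_eq h, semilocalGroundEnergy_window h _ hδ', ← weilEvenGroundEnergy_eq_sInf] at hm

/-- **THE HALF-ROOM LAW AT A WALL, even sector**: `−log q/√q ≤ λ_min(S_q; (log q)/2 + δ; even) ≤ −log q/√q + 2·ε_od(δ)`. -/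
theorem semilocalGroundEnergy_primesBelow_even_mem_Icc (h : ConsecutivePrimes q q') (hδ0 : 0 < δ)
    (hδq' : Real.log q / 2 + δ ≤ Real.log q' / 2) (hδ : 2 * δ < Real.log q) (hpos : WeilPositivityOn (Real.log q / 2 + δ)) :
    semilocalGroundEnergy (Nat.primesBelow q) (fun g ↦ ∀ t, g (-t) = g t) (Real.log q / 2 + δ) ∈
      Icc (-(Real.log q / Real.sqrt q)) (-(Real.log q / Real.sqrt q) + 2 * weilOddGroundEnergy δ) := by
  have hposS := weilSemilocalPositivityOn_primesBelow_of_weilPositivityOn h hδq' hpos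
  have hm := semilocalGroundEnergy_erase_even_mem_Icc h.1 (mem_primesBelow_of_consecutive h) hδ0 hδ hposS
  have hδ' : δ ≤ Real.log q' / 2 := by linarith [log_prime_pos h.1]
  rwa [primesBelow_erase_eq h, semilocalGroundEnergy_window h _ hδ', ← weilOddGroundEnergy_eq_sInf] at hm

/-- **THE HALF-ROOM LAW AT A WALL, all sectors**: `−log q/√q ≤ λ_min(S_q; (log q)/2 + δ) ≤ −log q/√q + 2·ε(δ)`. -/
theorem semilocalGroundEnergy_primesBelow_top_mem_Icc (h : ConsecutivePrimes q q') (hδ0 : 0 < δ)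
    (hδq' : Real.log q / 2 + δ ≤ Real.log q' / 2) (hδ : 2 * δ < Real.log q) (hpos : WeilPositivityOn (Real.log q / 2 + δ)) :
    semilocalGroundEnergy (Nat.primesBelow q) (fun _ ↦ True) (Real.log q / 2 + δ) ∈
      Icc (-(Real.log q / Real.sqrt q)) (-(Real.log q / Real.sqrt q) + 2 * weilGroundEnergy δ) := by
  have hposS := weilSemilocalPositivityOn_primesBelow_of_weilPositivityOn h hδq' hpos
  have hm := semilocalGroundEnergy_erase_top_mem_Icc h.1 (mem_primesBelow_of_consecutive h) hδ0 hδ hposS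
  have hδ' : δ ≤ Real.log q' / 2 := by linarith [log_prime_pos h.1]
  rwa [primesBelow_erase_eq h, semilocalGroundEnergy_window_top h hδ'] at hm

/-- In the deficit language of `HandoffSemilocalEnergy` (`D_q(b) = −λ_min(S_q; b)`, `cap(q) = log q/√q`): under Weil positivity on
`C(b)`, `b = (log q)/2 + δ` inside the new cone, the aggregate deficit of the old form is pinned to
`cap(q) − 2ε(δ) ≤ D_q(b) ≤ cap(q)`. -/
theorem aggregateDeficit_mem_Icc (h : ConsecutivePrimes q q') (hδ0 : 0 < δ) (hδq' : Real.log q / 2 + δ ≤ Real.log q' / 2)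
    (hδ : 2 * δ < Real.log q) (hpos : WeilPositivityOn (Real.log q / 2 + δ)) :
    aggregateDeficit q (Real.log q / 2 + δ) ∈
      Icc (Real.log q / Real.sqrt q - 2 * weilGroundEnergy δ) (Real.log q / Real.sqrt q) := by
  have hm := semilocalGroundEnergy_primesBelow_top_mem_Icc h hδ0 hδq' hδ hpos
  rw [mem_Icc] at hm ⊢
  unfold aggregateDeficit
  constructor <;> linarith [hm.1, hm.2]


/-! ## §5  THRESHOLD OFFSET LAW (appended, cc-s2-1 gen13): where the wall of the old form can be -/

/-- Consecutive primes never straddle a square: `log q' < 2·log q` (Bertrand: `q' < q²`, and `q²` is not prime). -/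
theorem log_lt_two_mul_log_of_consecutivePrimes (h : ConsecutivePrimes q q') : Real.log q' < 2 * Real.log q := by
  have hq2 : 2 ≤ q := h.1.two_le
  have hle : q' ≤ q ^ 2 := by have := h.pred_lt_sq; omega
  have hne : q' ≠ q ^ 2 := by
    intro he
    have hdvd : q ∣ q' := by rw [he, pow_two]; exact dvd_mul_right q q
    have := (Nat.prime_dvd_prime_iff_eq h.1 h.2.1).1 hdvd
    have hlt := h.2.2.1
    omega
  have hlt : (q' : ℝ) < (q : ℝ) ^ 2 := by exact_mod_cast lt_of_le_of_ne hle hne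
  have hq'pos : (0 : ℝ) < q' := by exact_mod_cast h.2.1.pos
  have := Real.log_lt_log hq'pos hlt
  rwa [Real.log_pow, Nat.cast_ofNat] at this

/-- **THRESHOLD OFFSET LAW (under one rung).** Consecutive primes `q < q'`, a half-room `0 < δ` with `(log q)/2 + δ ≤ (log q')/2`,
Weil positivity on `C((log q)/2 + δ)`: if twice the `ζ`-window energy at half-room is below the cap, `2ε(δ) < log q/√q`, then the
OLD form `Q_{S_q}` (`S_q` = primes `< q`) has ALREADY FAILED at that window: `a*(S_q) < (log q)/2 + δ`
(`a*` = `weilSemilocalThreshold` of MotivicDoorSemilocalThreshold).  I.e. the wall offset `a*(S_q) − (log q)/2` is `< δ` for every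
such `δ` — the theorem side of the cell's wall-offset coordinate (A4 walls, CLIFF/C-X rows). From §4's deficit sandwich. -/
theorem weilSemilocalThreshold_primesBelow_lt_of_weilPositivityOn (h : ConsecutivePrimes q q') (hδ0 : 0 < δ)
    (hδq' : Real.log q / 2 + δ ≤ Real.log q' / 2) (hpos : WeilPositivityOn (Real.log q / 2 + δ))
    (hε : 2 * weilGroundEnergy δ < Real.log q / Real.sqrt q) :
    MotivicDoor.SemilocalThreshold.weilSemilocalThreshold (Nat.primesBelow q) < Real.log q / 2 + δ := by
  have hδ : 2 * δ < Real.log q := by linarith [log_lt_two_mul_log_of_consecutivePrimes h]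
  have hm := (aggregateDeficit_mem_Icc h hδ0 hδq' hδ hpos).1
  exact aggregateDeficit_pos_iff.1 (by linarith)

/-- **THRESHOLD OFFSET LAW under RH.** For all consecutive primes `q < q'` and every `0 < δ ≤ (log q' − log q)/2` with
`2ε(δ) < log q/√q`: `a*(S_q) < (log q)/2 + δ`. -/
theorem weilSemilocalThreshold_primesBelow_lt_of_riemannHypothesis (hRH : Summit.RiemannHypothesis) (h : ConsecutivePrimes q q')
    (hδ0 : 0 < δ) (hδq' : Real.log q / 2 + δ ≤ Real.log q' / 2) (hε : 2 * weilGroundEnergy δ < Real.log q / Real.sqrt q) :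
    MotivicDoor.SemilocalThreshold.weilSemilocalThreshold (Nat.primesBelow q) < Real.log q / 2 + δ := by
  have hb : 0 < Real.log q / 2 + δ := by
    have : 0 ≤ Real.log q := Real.log_nonneg (by exact_mod_cast h.1.one_lt.le)
    linarith
  exact weilSemilocalThreshold_primesBelow_lt_of_weilPositivityOn h hδ0 hδq' (MotivicDoor.Rungs.rung_of_riemannHypothesis hRH hb) hε

/-- **FALSIFIER form.** A certified wall BEYOND the offset band — `(log q)/2 + δ ≤ a*(S_q)` for some `0 < δ ≤ (log q' − log q)/2` with
`2ε(δ) < log q/√q` (ε = the tree's window energy `weilGroundEnergy`) — refutes RH. -/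
theorem not_riemannHypothesis_of_le_weilSemilocalThreshold_primesBelow (h : ConsecutivePrimes q q') (hδ0 : 0 < δ)
    (hδq' : Real.log q / 2 + δ ≤ Real.log q' / 2) (hε : 2 * weilGroundEnergy δ < Real.log q / Real.sqrt q)
    (hwall : Real.log q / 2 + δ ≤ MotivicDoor.SemilocalThreshold.weilSemilocalThreshold (Nat.primesBelow q)) :
    ¬ Summit.RiemannHypothesis := fun hRH ↦ by
  have := weilSemilocalThreshold_primesBelow_lt_of_riemannHypothesis hRH h hδ0 hδq' hε
  linarith

end Summit.RiemannHypothesis.RiemannHypothesis.Theorems.SemilocalDeletionDipoleHalfRoom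

end

-- Build note (cc-s2-1 gen13, 2026-08-24): comment-only re-land under lead ruling R14-3 (1) to trigger the missing hub
-- build of this module (p368558 accepted 2026-08-24T07:36Z, no olean since); every declaration above is byte-identical.
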